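import Summits.RiemannHypothesis.RiemannHypothesis.Theorems.SemilocalNegCertTwentyThreeKinked1690
import HarnessLib

/-!
# Semi-local threshold of the `{∞,2,…,23}` form, negative side: `a*({2,…,23}) ≤ 865/512 (= 1730/1024)` — the wall `q = 29` from a KINKED (piecewise-cubic) witness with a reduced kink set (part 6/15: the kernel facts piece 60 … piece 71 of 149 (imports part 1 only))

Cell `rh-explicit` (HOME `run/shared/lean/pub/rh-explicit/`), seat cc-s2-9 gen0 (HUMAN RULING D-0074 (D5) WEIL data engine; LADDER-RH column WEIL, rung DATA → W-P(P2);
pipeline = cc-s2-4 gen8/gen11's piecewise-witness layer `SemilocalPiecewise{Witness,Increment,IncrementSum,Cert}.lean` + their float finder, every number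
re-derived by an independent second engine E2 before filing).  HONEST FRAMING: RH-FREE theorems about the tree's `weilSemilocalThreshold S` of a
TRUNCATED Weil form (finitely many places); nothing here bears on the truth of RH; the lower clause `(log q)/2 ≤ a*(S_q)` at all primes IS RH and is untouched.

Fourth kinked row of this seat (walls q = 17, 19, 23 before it).  REDUCED KINK SET (kit j250048, two engines): at `b = 865/512 = a*(S_29) + 0.0057` the slope breaks at the
images of the ELEVEN atoms `2, 3, 4, 5, 7, 9, 11, 13, 17, 19, 23` (weights `Λ(n)/√n ≥ 0.35`; the images of `8, 16, 25, 27` dropped) give `λ_min = −2.921·10⁻³` (all fifteen: `−1.22·10⁻²`;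
nine: `−1.73·10⁻³`); the tree's polynomial row is `435/256` at degree 19 (`SemilocalNegCertTwentyThreeLight`, `δ*(29) ≤ 0.0156`).  Instance: `S = {2,…,23}`, `N = 29`
(atom table `atomsTwentyThreeL` / `atomsEnclose_TwentyThreeL`), 12 pieces of degree ≤ 3; TWO ENGINES on the witness: cc-s2-4's float finder `−2.9212·10⁻³`, E2 `−2.9219·10⁻³`
(no polar credit); exact kernel margin `(rhs − lhs)/‖G‖² = 2.910e-03` (farm report, 149 `t`-pieces).  ⇒ **`a*({2,…,23}) ≤ 865/512`, `δ*(29) ≤ 0.00581`** (was `0.0156`); DATA (cc6 certified walls): `a*(S_29) = 1.683763`,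
`δ*(29) ≈ 1.2·10⁻⁴`.  No data is trusted: every bound is a `decide +kernel` fact of `SemilocalPiecewiseCert.lean`.  Folklore throughout.
-/

set_option autoImplicit false
set_option linter.dupNamespace false  -- the mandated namespace repeats `RiemannHypothesis`
set_option Elab.async false  -- serialise the kernel facts: in parallel they exhaust the node's per-process heap (cc-s2-4 gen11, CC4-LEAN §16.10)

noncomputable section

open Complex Filter Set MeasureTheory Topology
open scoped Real

namespace Summit.RiemannHypothesis.RiemannHypothesis.Theorems.SemilocalPolyWitness

open MeasureTheory Set Finset Real
open Literature.NumberTheory.LFunctions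
open Summit.RiemannHypothesis.RiemannHypothesis.Theorems.MotivicDoor
open Summit.RiemannHypothesis.RiemannHypothesis.Theorems.MotivicDoor.SemilocalThreshold
open Summit.RiemannHypothesis.RiemannHypothesis.Theorems.MotivicDoor.SemilocalMarkov
open LQ

set_option maxHeartbeats 0 in
/-- kernel fact: piece `60` of `certTwentyThreeKinked1690`. -/
theorem check_TwentyThreeKinked1690_piece60 : certTwentyThreeKinked1690.checkPiecePW 60 = true := by
  decide +kernel

set_option maxHeartbeats 0 in
/-- kernel fact: piece `61` of `certTwentyThreeKinked1690`. -/
theorem check_TwentyThreeKinked1690_piece61 : certTwentyThreeKinked1690.checkPiecePW 61 = true := by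
  decide +kernel

set_option maxHeartbeats 0 in
/-- kernel fact: piece `62` of `certTwentyThreeKinked1690`. -/
theorem check_TwentyThreeKinked1690_piece62 : certTwentyThreeKinked1690.checkPiecePW 62 = true := by
  decide +kernel

set_option maxHeartbeats 0 in
/-- kernel fact: piece `63` of `certTwentyThreeKinked1690`. -/
theorem check_TwentyThreeKinked1690_piece63 : certTwentyThreeKinked1690.checkPiecePW 63 = true := by
  decide +kernel

set_option maxHeartbeats 0 in
/-- kernel fact: piece `64` of `certTwentyThreeKinked1690`. -/
theorem check_TwentyThreeKinked1690_piece64 : certTwentyThreeKinked1690.checkPiecePW 64 = true := by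
  decide +kernel

set_option maxHeartbeats 0 in
/-- kernel fact: piece `65` of `certTwentyThreeKinked1690`. -/
theorem check_TwentyThreeKinked1690_piece65 : certTwentyThreeKinked1690.checkPiecePW 65 = true := by
  decide +kernel

set_option maxHeartbeats 0 in
/-- kernel fact: piece `66` of `certTwentyThreeKinked1690`. -/
theorem check_TwentyThreeKinked1690_piece66 : certTwentyThreeKinked1690.checkPiecePW 66 = true := by
  decide +kernel

set_option maxHeartbeats 0 in
/-- kernel fact: piece `67` of `certTwentyThreeKinked1690`. -/
theorem check_TwentyThreeKinked1690_piece67 : certTwentyThreeKinked1690.checkPiecePW 67 = true := by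
  decide +kernel

set_option maxHeartbeats 0 in
/-- kernel fact: piece `68` of `certTwentyThreeKinked1690`. -/
theorem check_TwentyThreeKinked1690_piece68 : certTwentyThreeKinked1690.checkPiecePW 68 = true := by
  decide +kernel

set_option maxHeartbeats 0 in
/-- kernel fact: piece `69` of `certTwentyThreeKinked1690`. -/
theorem check_TwentyThreeKinked1690_piece69 : certTwentyThreeKinked1690.checkPiecePW 69 = true := by
  decide +kernel

set_option maxHeartbeats 0 in
/-- kernel fact: piece `70` of `certTwentyThreeKinked1690`. -/
theorem check_TwentyThreeKinked1690_piece70 : certTwentyThreeKinked1690.checkPiecePW 70 = true := by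
  decide +kernel

set_option maxHeartbeats 0 in
/-- kernel fact: piece `71` of `certTwentyThreeKinked1690`. -/
theorem check_TwentyThreeKinked1690_piece71 : certTwentyThreeKinked1690.checkPiecePW 71 = true := by
  decide +kernel

end Summit.RiemannHypothesis.RiemannHypothesis.Theorems.SemilocalPolyWitness

end
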